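import Summits.MatrixMultiplication.MatrixMultiplication.Theorems.FarEdgeDescentKoszulFloor
import Summits.MatrixMultiplication.MatrixMultiplication.Theorems.FarEdgeDescentTower
import HarnessLib

/-!
# Far-edge descent, kernel XXXIX-F — the Landsberg–Ottaviani floor read out: `β ≥ 2 − 1/a`

Corollaries of `FarEdgeDescentKoszulFloor.lo_floor` (`∑_{kᵢ=1} mᵢ + (2p+1)·∑_{kᵢ=p+1} mᵢ ≤
R̲(⊕ᵢ⟨kᵢ,mᵢ,kᵢ⟩)`, every field) for the objects of the far-edge dictionary:

* §1 ANCHORED OBJECTS with legs of a common width `a ≥ 2`: `anchored_lo_floor` —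
  **`Q + (2a−1)·∑Bᵢ ≤ R̲(⟨1,Q,1⟩ ⊕ ⊕ᵢ⟨a,Bᵢ,a⟩)`**; `anchoredPair_lo_floor` — `Q + (2a−1)B ≤
  R̲(⟨1,Q,1⟩ ⊕ ⟨a,B,a⟩)`; and the ANCHOR-BUDGET DIAL's factor: a certificate `R̲ ≤ Q + β·(a∑Bᵢ)`
  forces **`β ≥ 2 − 1/a`** (`anchored_lo_budget`; every field, every anchor `Q`, any number of legs),
  `β ≥ 7/4` once `a ≥ 4` (`anchored_lo_budget_four`).  Kernel XXXIX-D had `β ≥ 3/2` (Strassen,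
  characteristic `0`); Schönhage's objects realise `β = 2`.  The tensor-open window of the lens
  dichotomy is `[2 − 1/a, 2)` per width, of length `1/a`; in the dial model (kernel XXXVIII,
  `θ_β > 1 ⟺ β < 1 + √2/2 = 1.707…`) only legs of width `2` or `3` could carry a super-linear order.
* §2 BARE MULTIPLES: `multiple_lo_floor` / `multiple_lo_floor_kronecker` — **`c(2A−1)M ≤ R̲(⟨c⟩ ⊗
  ⟨A,M,A⟩)`**; `readout_lo_floor` — any certificate `R̲(⟨c⟩ ⊗ ⟨A,M,A⟩) ≤ r` has `c(2A−1)M ≤ r`: the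
  one-shot readout of kernel XXXIX-C (`readout`: `c·A^{ω(1,x*,1)} ≤ r`) can never certify better than
  `A^{ω(1,x*,1) − (x*+1)} ≥ 2 − 1/A`, slack `≥ log(2 − 1/A)/log A` in the exponent (`0.58` at `A = 2`,
  `0.40` at `A = 4`, `0.23` at `A = 16`; versus `log(3/2)/log A` from Strassen's floor).

HONEST FRAMING: arithmetic corollaries of the Koszul floor; no upper bounds; nothing on
`AnchoredLogConvexity`.  Def-free.

## References
* J. M. Landsberg, G. Ottaviani, Theory Comput. 11 (2015), Thm. 1.1. [LandsbergOttaviani2015]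
* J. M. Landsberg, *Geometry and Complexity Theory*, CUP 2017, Thm. 2.5.2.6. [Landsberg2017]
-/

noncomputable section

open scoped BigOperators
open Matrix Finset

set_option linter.dupNamespace false

namespace Summit.MatrixMultiplication.MatrixMultiplication.Theorems.FarEdgeDescentKoszulFloorReadout

open Literature.Computability.AlgebraicComplexity
open Summit.MatrixMultiplication.MatrixMultiplication.Theorems.FarEdgeDescentKoszulFloor

variable (K : Type) [Field K]

/-! ## §1 Anchored objects and the dial's budget factor -/

/-- **`Q + (2a−1)·∑Bᵢ ≤ R̲(⟨1,Q,1⟩ ⊕ ⊕ᵢ⟨a,Bᵢ,a⟩)`** for legs of a common width `a ≥ 2`, every field.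
[cite: LandsbergOttaviani2015, Thm 1.1] -/
theorem anchored_lo_floor {c : ℕ} (a Q : ℕ) (B : Fin c → ℕ) (ha : 2 ≤ a) :
    Q + (2 * a - 1) * ∑ i, B i ≤
      algBorderRank (matMulDirectSum K (Fin.cons 1 fun _ => a) (Fin.cons Q B)
        (Fin.cons 1 fun _ => a)) := by
  classical
  have h := lo_floor K (Fin.cons 1 fun _ : Fin c => a) (Fin.cons Q B) (a - 1) (by omega)
  have ha1 : a - 1 + 1 = a := by omega
  have hne : ¬ a = 1 := by omega
  have hne' : ¬ (1 : ℕ) = a := by omega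
  simp only [ha1, Finset.sum_filter, Fin.sum_univ_succ, Fin.cons_zero, Fin.cons_succ, if_true,
    hne, hne', if_false, Finset.sum_const_zero, add_zero, zero_add] at h
  have h2a : 2 * (a - 1) + 1 = 2 * a - 1 := by omega
  rw [h2a] at h
  simpa using h

/-- Legs of mixed widths (the `Fin.cons` format of `FarEdgeDescentTower`): for every `p ≥ 1`,
`Q + (2p+1)·∑_{kᵢ = p+1} mᵢ ≤ R̲(⟨1,Q,1⟩ ⊕ ⊕ᵢ⟨kᵢ,mᵢ,kᵢ⟩)` — the legs of width `p + 1` at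
Landsberg–Ottaviani weight, the anchor at full weight, the other legs dropped.
[cite: LandsbergOttaviani2015, Thm 1.1] -/
theorem anchored_lo_floor_width {c : ℕ} (k m : Fin c → ℕ) (Q p : ℕ) (hp : 1 ≤ p) :
    Q + (2 * p + 1) * ∑ i ∈ univ.filter (fun i => k i = p + 1), m i ≤
      algBorderRank (matMulDirectSum K (Fin.cons 1 k) (Fin.cons Q m) (Fin.cons 1 k)) := by
  classical
  have h := lo_floor K (Fin.cons 1 k) (Fin.cons Q m) p hp
  have hne : ¬ (1 : ℕ) = p + 1 := by omega
  simp only [Finset.sum_filter, Fin.sum_univ_succ, Fin.cons_zero, Fin.cons_succ, if_true, hne,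
    if_false, zero_add] at h
  rw [Finset.sum_filter]
  have h0 : 0 ≤ ∑ i : Fin c, (if k i = 1 then m i else 0) := Nat.zero_le _
  omega

/-- **The budget factor of the anchor-budget dial for legs of width `a`: `β ≥ 2 − 1/a`.**  A
certificate `R̲(⟨1,Q,1⟩ ⊕ ⊕ᵢ⟨a,Bᵢ,a⟩) ≤ Q + β·(a∑Bᵢ)` forces `2 − 1/a ≤ β`, every field, every
anchor. [cite: LandsbergOttaviani2015, Thm 1.1] -/
theorem anchored_lo_budget {c : ℕ} (a Q : ℕ) (B : Fin c → ℕ) (ha : 2 ≤ a) (hL : 0 < ∑ i, B i)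
    {β : ℝ}
    (h : (algBorderRank (matMulDirectSum K (Fin.cons 1 fun _ => a) (Fin.cons Q B)
        (Fin.cons 1 fun _ => a)) : ℝ) ≤ Q + β * (a * ∑ i, B i)) :
    2 - 1 / (a : ℝ) ≤ β := by
  have hf := anchored_lo_floor K a Q B ha
  have hf' : ((Q + (2 * a - 1) * ∑ i, B i : ℕ) : ℝ) ≤ Q + β * (a * ∑ i, B i) :=
    (Nat.cast_le.2 hf).trans h
  have ha' : (0 : ℝ) < a := by exact_mod_cast (show 0 < a by omega)
  have hL' : (0 : ℝ) < ∑ i, (B i : ℝ) := by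
    rw [← Nat.cast_sum]
    exact_mod_cast hL
  have h21 : ((2 * a - 1 : ℕ) : ℝ) = 2 * a - 1 := by
    rw [Nat.cast_sub (by omega)]
    push_cast
    ring
  push_cast at hf'
  rw [h21] at hf'
  have key : (2 * (a : ℝ) - 1) * ∑ i, (B i : ℝ) ≤ β * a * ∑ i, (B i : ℝ) := by nlinarith
  have key' : 2 * (a : ℝ) - 1 ≤ β * a := le_of_mul_le_mul_right key hL'
  have key'' : (2 - 1 / (a : ℝ)) * a ≤ β * a := by
    rw [sub_mul, div_mul_cancel₀ _ ha'.ne']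
    linarith
  exact le_of_mul_le_mul_right key'' ha'

/-- Width `a ≥ 4` forces `β ≥ 7/4` — past the model-level threshold `1 + √2/2` of a super-linear dial
order (kernel XXXVIII): only legs of width `2` or `3` can carry `θ_β > 1`.
[cite: LandsbergOttaviani2015, Thm 1.1] -/
theorem anchored_lo_budget_four {c : ℕ} (a Q : ℕ) (B : Fin c → ℕ) (ha : 4 ≤ a)
    (hL : 0 < ∑ i, B i) {β : ℝ}
    (h : (algBorderRank (matMulDirectSum K (Fin.cons 1 fun _ => a) (Fin.cons Q B)
        (Fin.cons 1 fun _ => a)) : ℝ) ≤ Q + β * (a * ∑ i, B i)) :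
    7 / 4 ≤ β := by
  have hb := anchored_lo_budget K a Q B (by omega) hL h
  have ha' : (4 : ℝ) ≤ a := by exact_mod_cast ha
  have : 1 / (a : ℝ) ≤ 1 / 4 := one_div_le_one_div_of_le (by norm_num) ha'
  linarith

/-- **The anchored pair: `Q + (2a−1)B ≤ R̲(⟨1,Q,1⟩ ⊕ ⟨a,B,a⟩)`** (`a ≥ 2`, every field; Strassen's
floor of kernel XXXIX gave `Q + (3/2)aB` in characteristic `0`). [cite: LandsbergOttaviani2015, Thm 1.1] -/
theorem anchoredPair_lo_floor (Q a B : ℕ) (ha : 2 ≤ a) :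
    Q + (2 * a - 1) * B ≤ algBorderRank (matMulDirectSum K ![1, a] ![Q, B] ![1, a]) := by
  classical
  have h := lo_floor K ![1, a] ![Q, B] (a - 1) (by omega)
  have ha1 : a - 1 + 1 = a := by omega
  have hne : ¬ a = 1 := by omega
  have hne' : ¬ (1 : ℕ) = a := by omega
  simp only [ha1, Finset.sum_filter, Fin.sum_univ_two, Matrix.cons_val_zero, Matrix.cons_val_one,
    if_true, hne, hne', if_false, add_zero, zero_add] at h
  have h2a : 2 * (a - 1) + 1 = 2 * a - 1 := by omega
  rwa [h2a] at h

/-! ## §2 Bare multiples and the one-shot readout -/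

/-- **Bare multiples: `c(2A−1)M ≤ R̲(⊕_c ⟨A,M,A⟩)`** for `A ≥ 2`, every field — the relative surplus
`1 − 1/A` does not wash out with the multiplicity. [cite: LandsbergOttaviani2015, Thm 1.1] -/
theorem multiple_lo_floor (c A M : ℕ) (hA : 2 ≤ A) :
    c * ((2 * A - 1) * M) ≤
      algBorderRank (matMulDirectSum K (fun _ : Fin c => A) (fun _ => M) (fun _ => A)) := by
  classical
  have h := lo_floor K (fun _ : Fin c => A) (fun _ => M) (A - 1) (by omega)
  have hA1 : A - 1 + 1 = A := by omega
  have hne : ¬ A = 1 := by omega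
  simp only [hA1, hne, Finset.filter_false, Finset.filter_true, Finset.card_empty, zero_mul,
    zero_add, Finset.sum_const, Finset.card_univ, Fintype.card_fin, smul_eq_mul] at h
  have h2a : 2 * (A - 1) + 1 = 2 * A - 1 := by omega
  rw [h2a] at h
  calc c * ((2 * A - 1) * M) = (2 * A - 1) * (c * M) := by ring
    _ ≤ _ := h

/-- The same floor for the Kronecker form `⟨c⟩ ⊗ ⟨A,M,A⟩` of the multiple (the form the readout
dictionary uses). [cite: LandsbergOttaviani2015, Thm 1.1] -/
theorem multiple_lo_floor_kronecker (c A M : ℕ) (hA : 2 ≤ A) :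
    c * ((2 * A - 1) * M) ≤
      algBorderRank (kroneckerTensor (unitTensor K c) (matMulTensor K A M A)) :=
  (multiple_lo_floor K c A M hA).trans
    (FarEdgeDescentTower.tensorRestrictsTo_multiple_directSum K c A M).algBorderRank_le

/-- **The floor under every one-shot readout certificate**: `R̲(⟨c⟩ ⊗ ⟨A,M,A⟩) ≤ r` forces
`c(2A−1)M ≤ r`, i.e. `A^{ω(1,x*,1) − (x*+1)} ≥ 2 − 1/A` is all the readout of kernel XXXIX-C can
certify (`x* = log M / log A`). [cite: LandsbergOttaviani2015, Thm 1.1] -/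
theorem readout_lo_floor {c A M r : ℕ} (hA : 2 ≤ A)
    (h : algBorderRank (kroneckerTensor (unitTensor K c) (matMulTensor K A M A)) ≤ r) :
    c * ((2 * A - 1) * M) ≤ r :=
  (multiple_lo_floor_kronecker K c A M hA).trans h

/-- Real form of the readout floor: `(2 − 1/A)·(cAM) ≤ r`. [cite: LandsbergOttaviani2015, Thm 1.1] -/
theorem readout_lo_floor_real {c A M r : ℕ} (hA : 2 ≤ A)
    (h : algBorderRank (kroneckerTensor (unitTensor K c) (matMulTensor K A M A)) ≤ r) :
    (2 - 1 / (A : ℝ)) * ((c : ℝ) * A * M) ≤ r := by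
  have hf := readout_lo_floor K hA h
  have hf' : ((c * ((2 * A - 1) * M) : ℕ) : ℝ) ≤ r := by exact_mod_cast hf
  have hA' : (0 : ℝ) < A := by exact_mod_cast (show 0 < A by omega)
  have h21 : ((2 * A - 1 : ℕ) : ℝ) = 2 * A - 1 := by
    rw [Nat.cast_sub (by omega)]
    push_cast
    ring
  push_cast at hf'
  rw [h21] at hf'
  calc (2 - 1 / (A : ℝ)) * ((c : ℝ) * A * M) = (c : ℝ) * ((2 * A - 1) * M) := by
        field_simp
    _ ≤ r := hf'

end Summit.MatrixMultiplication.MatrixMultiplication.Theorems.FarEdgeDescentKoszulFloorReadout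

end
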